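import Summits.HodgeConjecture.HodgeConjecture.Theorems.HCCMUnconditionalOfGenericFloorV7
import Summits.HodgeConjecture.CorCM.Hyp413.A3Liu413FaceTypes
import Summits.HodgeConjecture.HodgeConjecture.Theorems.H413CohFormsCarriers
import Literature.NumberTheory.Li1992.RallisInnerProductThetaLift
import Literature.NumberTheory.Li1992.RallisKernelIdentity
import Summits.HodgeConjecture.HodgeConjecture.Theorems.H413CuspCotPin
import Summits.HodgeConjecture.HodgeConjecture.Theorems.P4StubT2cCohClassMapOfHol
import Summits.HodgeConjecture.HodgeConjecture.Theorems.H413TowerConjPin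
import Summits.HodgeConjecture.HodgeConjecture.Theorems.H413AdmissibleLineSign
import Summits.HodgeConjecture.HodgeConjecture.Theorems.H413LineTransportAllFrames
import Summits.HodgeConjecture.HodgeConjecture.Theorems.H413ConjugatePartnerAtHolds
import Summits.HodgeConjecture.HodgeConjecture.Theorems.F0FloorSockets
import Summits.HodgeConjecture.HodgeConjecture.Theorems.H413HolThetaAtAdmissibleLineFold
import Summits.HodgeConjecture.HodgeConjecture.Theorems.H413ChiNRowAtPin
import Summits.HodgeConjecture.HodgeConjecture.Theorems.H413HoccGlue
import HarnessLib

/-!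
# Crux H413 ∕ FLOOR-0 socket F0Hocc (stmt-HodgeConjecture-27457): the P4 line's composition RE-HOMED to `Theorems/` — `HoccType` MODULO RALLIS ONLY

HC_CM is proved only modulo the printed citations until rung 0 closes.  Cell `hodgecm-mathlib` (D-0151), programme P4; F0P4-plan (g4) ROAD (β) ruling
2026-08-31T04:44:05Z (precedent 27454: ★ p807780 `Theorems/F0HFOfSiegelModuli` + ★ p808150); author A-p17 (g14), the named hand for the socket closer
(A-plan1 (g19) 04:37:09Z).  WHY: `Cruxes/…/Lines/*` are gate-elaborated workfiles with no standing farm olean, so a `Theorems/` closer cannot import the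
P4 line `Cruxes/H413/Lines/F0_P4AdmissibleOccursInH1.lean` (ED. 3.4); its kernel-checked composition is therefore PORTED here decl-for-decl: every
registered stub is its ★ closer BY NAME (through ★ `Theorems/H413HoccGlue` where that glue is already re-homed) (T2a ★ `CuspCot.t2a_holClassMapAt`, T2b ★ `TowerConj.towerConjugationAt_pin`, T2c ★ `P4StubT2cCohClassMapOfHol.stubT2cCohClassMapOfHol_holds`,
S4a ★ `LineTransport.lineTransportAt`, S4b ★ `ThetaJunction.holThetaAtAdmissibleLine_fold RallisTransport.chiN_of_rankOneContCM` (ED. 3.4), S5 ★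
`ConjugatePartner.stubT3bConjugatePartnerAt_holds`), the line's Prop alias `StubT3aHolThetaRealisationOfRallisAt` is spelled out (the one conclusion not in ★ `HoccGlue`), its data `def` `pinRep`
is inlined as a `let`, and the ONE open stub S6 — [Li1992, Thm 2.1] at rank one, CM letter ED. 4
`Li1992.RallisInnerProductFormulaUnitaryDualPairRankOneContCM` — is the explicit hypothesis `hR` (= ★ `E2RallisRankOne.rallisRankOneContCM_of_kernelCM
(E2SiegelWeil.kernelRallisIdentityCM_of_siegelWeil hSW)`, ★ p810320 ∘ ★ p810576, `hSW` the Siegel–Weil identity in Weil's range).  No `def`, no `sorry`,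
no `Lines` import; heartbeat options = the line's, verbatim (lint debt noted there).

* §1 `exists_realisation_of_equiv` (the line's generic transport lemma, verbatim);
* §2 `t3aHolThetaRealisationOfRallisAt` — T3a′ from the ★ closers S4a ∕ S4b (the line's `stubT3aOfRallis_of`, `pinRep` inlined) — the ONE node of the line
  not already re-homed (T2 = ★ `MatsushimaHodge.t2_matsushimaHodgeAt`, T3a→T3b→T3 and T2→T3→hocc = ★ `Theorems/H413HoccGlue`, A-p19 (g15));
* §3 **`hocc_of_rankOneContCM (hR) : F0FloorSockets.HoccType`** := `HoccGlue.hocc_of_thetaFormsAt (HoccGlue.thetaFormsAt_of_hol_of_partner (t3a… hR) ★S5)`.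

## References
[Liu2021] Prop. 4.13 and its proof (l. 2145), Def. 4.11–4.12, Lem. D.2 · [Li1992] Thm 2.1 (26) p. 184 · [BorelWallach2000] VII 2.10, 3.2, 3.6 ·
[GelbartRogawski1991] §3.1 Prop. 3.1.1 · [BorelJacquet1979] §4.2.
-/

set_option autoImplicit false

-- the mandated namespace has the single-problem summit's repeated segment (`HodgeConjecture.HodgeConjecture`), as in every
-- `Cruxes/…/Lines/*.lean` and `Theorems/*.lean` of this sub-problem
set_option linter.dupNamespace false

noncomputable section

namespace Summit.HodgeConjecture.HodgeConjecture.Cruxes.H413.HoccOfRallis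

open scoped TensorProduct Matrix
open NumberField NumberField.InfinitePlace IsDedekindDomain
open HodgeCM.Model HodgeCM.Model.LiuIndex HodgeCM.Model.TowerCarrier
open Summit.HodgeConjecture.CorCM.Model
open Literature.AlgebraicGeometry.Motives (CMType AbelianVariety)
open Literature.AlgebraicGeometry.HodgeTheory Literature.NumberTheory.Automorphic.PicardCM
open Literature.AlgebraicGeometry.ShimuraVarieties Literature.AlgebraicGeometry.ShimuraVarieties.UnitaryCanonicalModel
open Literature.NumberTheory.ComplexMultiplication
open Literature.NumberTheory.Automorphic
open Literature.NumberTheory.Automorphic.Liu2021 Literature.NumberTheory.Automorphic.Liu2021.AppendixC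
open Literature.NumberTheory.Automorphic.Liu2021.Def411WeilCarriers (lineOf locF Rep)
open Summit.HodgeConjecture.CorCM.Transposition.OmegaTransport (realUnit)
open HodgeCM.Model.ArchSideTerm (e₁)
open Literature.NumberTheory.GelbartRogawski1991 Literature.NumberTheory.GelbartRogawski1991.UnitaryDualPair
open Literature.RepresentationTheory Literature.RepresentationTheory.Liu2021
open Summit.HodgeConjecture.CorCM
open Summit.HodgeConjecture.CorCM.Transposition
open Literature.NumberTheory.GelbartRogawski1991.OscillatorTripleDictionary (OccursInH1 IsIsoToOmega)
open Summit.HodgeConjecture.CorCM.Lines.A3Liu418 (Thm415AtFace EpsRigidAtFace)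
open Summit.HodgeConjecture.HodgeConjecture.Theses (HCCMUnconditional.HDel)
open MulAction
open Literature.Geometry.ComplexHyperbolic.BallModel (U21 x₀)
open Literature.NumberTheory.GelbartRogawski1991.OscillatorTripleDictionary (rhoTriple)
open Summit.HodgeConjecture.CorCM.Lines.A3Liu413 (datum413)
open Summit.HodgeConjecture.HodgeConjecture.Cruxes.H413.CohFormsCarriers


/-! ## §1 Transport of a realisation along an equivariant isomorphism (the line's, verbatim) -/

/-- **Transport of a non-zero equivariant realisation along an equivariant linear isomorphism** (the linear algebra of «T3a-LT ∘ T3a″ ⇒ T3a′»): if `Ψ : Ω ≃ Ω'`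
intertwines `ρ` and `ρ'` (actions of `K`) and `θ' : Ω' → Y` is non-zero with values in `S` and `(ρ' ∘ ι, R)`-equivariant for `ι : G → K`, then `θ' ∘ Ψ` is
non-zero, `S`-valued and `(ρ ∘ ι, R)`-equivariant. [cite: BorelWallach2000, VII 2.10] -/
theorem exists_realisation_of_equiv {G K Ω Ω' Y : Type*} [AddCommGroup Ω] [Module ℂ Ω] [AddCommGroup Ω'] [Module ℂ Ω']
    [AddCommGroup Y] [Module ℂ Y] (S : Submodule ℂ Y) (ι : G → K) (ρ : K → Ω → Ω) (ρ' : K → Ω' → Ω') (R : G → Y → Y)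
    (Ψ : Ω ≃ₗ[ℂ] Ω') (hΨ : ∀ k x, Ψ (ρ k x) = ρ' k (Ψ x))
    (h : ∃ θ' : Ω' →ₗ[ℂ] Y, θ' ≠ 0 ∧ (∀ w, θ' w ∈ S) ∧ ∀ (g : G) (w : Ω'), θ' (ρ' (ι g) w) = R g (θ' w)) :
    ∃ θ : Ω →ₗ[ℂ] Y, θ ≠ 0 ∧ (∀ v, θ v ∈ S) ∧ ∀ (g : G) (v : Ω), θ (ρ (ι g) v) = R g (θ v) := by
  obtain ⟨θ', h0, hS, heq⟩ := h
  refine ⟨θ' ∘ₗ (Ψ : Ω →ₗ[ℂ] Ω'), fun hz => h0 ?_, fun v => hS (Ψ v), fun g v => ?_⟩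
  · ext w
    have hw := LinearMap.congr_fun hz (Ψ.symm w)
    simpa using hw
  · simp only [LinearMap.coe_comp, Function.comp_apply, LinearEquiv.coe_coe]
    rw [hΨ, heq]



/-! ## §2 The node T3a′ from the ★ closers S4a ∕ S4b (Rallis as hypothesis of the conclusion) -/

set_option synthInstance.maxHeartbeats 400000 in
set_option maxHeartbeats 8000000 in
/-- **T3a′ — holomorphic theta realisation of the `ι₁`-class modulo Rallis** (the line's `StubT3aHolThetaRealisationOfRallisAt`, spelled out), PROVED from
the ★ closers S4a `LineTransport.lineTransportAt` (T3a-LT) and S4b `ThetaJunction.holThetaAtAdmissibleLine_fold RallisTransport.chiN_of_rankOneContCM` (T3a″,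
ED. 3.4) by the line's glue `stubT3aOfRallis_of` token-for-token (its `pinRep` — the class section corrected at the pin's own line — inlined as a `let`).
DISJUNCT A; admissible line `(e, a)` of ★ `AdmissibleLine.exists_admissibleLine`; transport `θ := θ' ∘ Ψ`.
[cite: Liu2021, proof of Prop. 4.13, l. 2145; Def. 4.11–4.12] [cite: GelbartRogawski1991, §3.1 Prop. 3.1.1] -/
theorem t3aHolThetaRealisationOfRallisAt :
    Literature.NumberTheory.Li1992.RallisInnerProductFormulaUnitaryDualPairRankOneContCM →
    ∀ (hDel : Literature.AlgebraicGeometry.ShimuraVarieties.UnitaryCanonicalModel.canonicalModel_exists_printed)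
        (F : HodgeCM.CMField) [IsGalois ℚ F] (h6 : 6 ≤ Module.finrank ℚ F) {ι₁ : F →+* ℂ} (V : HodgeCM.HermSpace3 F ι₁) (a₀ : RealScalar F)
        (Φ : CMType F) (hΦ : ι₁ ∈ Φ.1) (i : (I V (repAt a₀) (muLiu ι₁ GramClass.rep))),
        (datum413 hDel F V a₀ Φ i).n = 3 →
          (∀ (t : (datum413 hDel F V a₀ Φ i).Triple), t.HasWeightOne → t.IsAdmissible → ι₁ ∈ t.cmType.1 →
              ∃ θ : (datum413 hDel F V a₀ Φ i).omega t.μ t.isConjugateSymplectic t.ε t.χ →ₗ[ℂ] ((adelicDatum F V).Adelic → (Fin 2 → ℂ)),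
                θ ≠ 0 ∧ (∀ v, θ v ∈ holCotForms (archFactorOf F V)) ∧
                  ∀ (g : ↥(HodgeCM.HermSpace3.adelicFin V)) (v : (datum413 hDel F V a₀ Φ i).omega t.μ t.isConjugateSymplectic t.ε t.χ),
                    θ (rhoTriple (datum413 hDel F V a₀ Φ i) t g v) = rightRep F V g (θ v)) ∨
          (∀ (t : (datum413 hDel F V a₀ Φ i).Triple), t.HasWeightOne → t.IsAdmissible → ι₁ ∉ t.cmType.1 →
              ∃ θ : (datum413 hDel F V a₀ Φ i).omega t.μ t.isConjugateSymplectic t.ε t.χ →ₗ[ℂ] ((adelicDatum F V).Adelic → (Fin 2 → ℂ)),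
                θ ≠ 0 ∧ (∀ v, θ v ∈ holCotForms (archFactorOf F V)) ∧
                  ∀ (g : ↥(HodgeCM.HermSpace3.adelicFin V)) (v : (datum413 hDel F V a₀ Φ i).omega t.μ t.isConjugateSymplectic t.ε t.χ),
                    θ (rhoTriple (datum413 hDel F V a₀ Φ i) t g v) = rightRep F V g (θ v)) := by
  intro hR hDel F _ h6 ι₁ V a₀ Φ hΦ i hn
  -- the pin's scalar-keyed representative section (the line's `pinRep`, inlined): `lineOf` corrected at the pin's own line to the global unit
  let rPin : Rep ↥(maximalRealSubfield (HodgeCM.CMField.K F)) (imagUnitSq (HodgeCM.CMField.K F)) :=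
    Rep.update ↥(maximalRealSubfield (HodgeCM.CMField.K F)) (imagUnitSq (HodgeCM.CMField.K F))
      (Rep.ofLineOf ↥(maximalRealSubfield (HodgeCM.CMField.K F)) (imagUnitSq (HodgeCM.CMField.K F)))
      (locF ↥(maximalRealSubfield (HodgeCM.CMField.K F)) (imagUnitSq (HodgeCM.CMField.K F))
        (realUnit ⟨HodgeCM.CMField.K F⟩ (repAt a₀ (Sigma.fst i)).1 (repAt a₀ (Sigma.fst i)).2.1 (repAt a₀ (Sigma.fst i)).2.2))
      (realUnit ⟨HodgeCM.CMField.K F⟩ (repAt a₀ (Sigma.fst i)).1 (repAt a₀ (Sigma.fst i)).2.1 (repAt a₀ (Sigma.fst i)).2.2) rfl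
  refine Or.inl fun t hw ht hι => ?_
  obtain ⟨e, a, he, hloc, ha, -⟩ :=
    Summit.HodgeConjecture.HodgeConjecture.Cruxes.H413.AdmissibleLine.exists_admissibleLine hDel F V a₀ Φ i t ht
  obtain ⟨Ψ, hΨ⟩ := Summit.HodgeConjecture.HodgeConjecture.Cruxes.H413.LineTransport.lineTransportAt ⟨HodgeCM.CMField.K F⟩ e₁ (frameD V) (frameD_real V) (frameD_ne V)
    (Literature.NumberTheory.Automorphic.IdeleClassGroup.toHeckeCharacter (HodgeCM.CMField.K F) t.μ)
    (Literature.NumberTheory.Automorphic.IdeleClassGroup.isUnitary_toHeckeCharacter (HodgeCM.CMField.K F) t.μ)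
    ((Literature.RepresentationTheory.Liu2021.isOscillatorChar_toHeckeCharacter_iff t.μ).mpr t.isConjugateSymplectic)
    (rPin.toFun t.ε) a t.χ ((rPin.locF_toFun t.ε ⟨a, hloc⟩).trans hloc.symm)
  exact exists_realisation_of_equiv (holCotForms (archFactorOf F V)) (ιVE V) _ _ (fun g f => rightRep F V g f) Ψ hΨ
    ((Summit.HodgeConjecture.HodgeConjecture.Cruxes.H413.ThetaJunction.holThetaAtAdmissibleLine_fold
      Summit.HodgeConjecture.HodgeConjecture.Cruxes.H413.RallisTransport.chiN_of_rankOneContCM)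
      hR hDel F h6 V a₀ Φ hΦ i hn t hw ht hι e a he hloc ha)

/-! ## §3 The socket head modulo Rallis -/

set_option synthInstance.maxHeartbeats 400000 in
set_option maxHeartbeats 8000000 in
/-- **THE P4 SOCKET HEAD AT `Theorems/` LEVEL, MODULO RALLIS ONLY** — `F0FloorSockets.HoccType` (admissible oscillator triples OCCUR in `H¹` at the printed
datum; the binder `hocc` of ★ `hc_cm_of_generic_floor_v7`) from `hR : Li1992.RallisInnerProductFormulaUnitaryDualPairRankOneContCM` (LETTER ED. 4) and the ★
closers of every other P4 stub, by the line's `admissible_occursInH1_holds_of` ∘ `occursInH1_of_classMap_of_thetaForms` token-for-token.  The 30-line closer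
`F0Hocc_holds --workitem stmt-HodgeConjecture-27457` is `hocc_of_rankOneContCM (E2RallisRankOne.rallisRankOneContCM_of_kernelCM (E2SiegelWeil.kernelRallisIdentityCM_of_siegelWeil
E2SWSiegelWeilCM.siegelWeil_weilRange_CM))` the day the Siegel–Weil identity is ★.  HC_CM is proved only modulo the printed citations until rung 0 closes.
[cite: Liu2021, proof of Prop. 4.13, l. 2145] [cite: Li1992, Thm. 2.1] -/
theorem hocc_of_rankOneContCM (hR : Literature.NumberTheory.Li1992.RallisInnerProductFormulaUnitaryDualPairRankOneContCM) :
    Summit.HodgeConjecture.HodgeConjecture.Theorems.F0FloorSockets.HoccType :=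
  -- ★ `HoccGlue` (A-p19 (g15)): `T3 → hocc` over the ★ T2 node `MatsushimaHodge.t2_matsushimaHodgeAt`, and `T3a → T3b → T3`; T3a := T3a′ at `hR`, T3b := ★ S5
  Summit.HodgeConjecture.HodgeConjecture.Cruxes.H413.HoccGlue.hocc_of_thetaFormsAt
    (Summit.HodgeConjecture.HodgeConjecture.Cruxes.H413.HoccGlue.thetaFormsAt_of_hol_of_partner
      (t3aHolThetaRealisationOfRallisAt hR)
      Summit.HodgeConjecture.HodgeConjecture.Cruxes.H413.ConjugatePartner.stubT3bConjugatePartnerAt_holds)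

end Summit.HodgeConjecture.HodgeConjecture.Cruxes.H413.HoccOfRallis

end
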